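/-
Copyright: width seat `ym-line-sll-p5` (prover-ym-line-sll-p5-g0-0), route `SoftLoopLongLag`, cruxes K′ `SoftLoopLagFloorToTorus`
(stmt-QuantumFields-22504, stub E2 `stub_innerDatumMeanSmoothG`) / T′ `ColdBoxSoftLoopLagFloor` (stmt-QuantumFields-24180, stub E1b
`stub_innerDatumCovStabilityG`), line `birth` — engine layer of the E-architecture: the loop observable under the sibling's KERNEL BRIDGE.
-/
import Summits.QuantumFields.YangMills.Theorems.ColdBoxAllGroupsBulkAllGroupsKernelBridgeG
import Summits.QuantumFields.YangMills.Theorems.SoftLoopLongLagSoftLoopLagFloorToTorusDlrTransferPlumbingG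
import Summits.QuantumFields.YangMills.Theorems.SoftLoopLongLagLoopKernelMeanDatumCore

/-!
# Route `SoftLoopLongLag`, E-architecture engine layer: the LOOP-COST observable under the kernel bridge of `ColdBoxAllGroups` — gauge
# invariance, bounds, locality on the enlarged box, and the bridge instances `γ(·|ω) = γ(·|W)` for loops based near the centre

WHAT.  The one-scale expansions behind the registered stubs E2 (`stub_innerDatumMeanSmoothG`, mean, datum) and E1b (`stub_innerDatumCovStabilityG`,
covariance, datum) run, exactly as the sibling's plaquette stubs N2-G, at the forest-fixed truncated gauge copy `W` of the crude-good datum `ω`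
(`ColdBoxAllGroups.integral_boxKernelG_eq_of_gauge_trunc`: kernel means of measurable, gauge-invariant observables local to the enlarged box
`E = boxEdgesAt dirCorner (2H+3)` agree at `ω` and at `W`).  This file supplies the loop instances of its three hypotheses and the resulting
bridge identities, for the LOOP COST `c_ℓ(U) = N − Re tr r(hol_ℓ(U))` of the rectangle `ℓ = rectWalk x 1 2 R T` (the observable of the N2-loops
interface of `SoftLoopLongLagInnerMeanSmoothOfExpansionG` / `SoftLoopLongLagInnerMeanSmoothLoopG`):

* §1 `isZdGaugeInvariant_sub_re_trace_walkHolonomy` (unscaled loop cost; the scaled `β·c_ℓ`, nonnegativity, `|c_ℓ| ≤ 2N` and measurability are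
  the width seat sll-p4's `SoftLoopLongLagLoopKernelMeanDatumCore`, imported), `isZdGaugeInvariant_loopCost_mul` (product of two loop costs, E1b),
  `continuous_/measurable_sub_re_trace_walkHolonomy` (tree `walkHolonomy_gaugeTransformZd`, cyclicity of the trace);
* §2 locality: `loopCost_eq_of_eqOn_darts` (cylinder on the walk's edges, tree `walkHolonomy_congr`), `rectWalk_edge_mem_boxEdgesAt`
  (every edge under a dart of `rectWalk x 1 2 R T` lies in `boxEdgesAt dirCorner (2H+3)` when `8|x_m − H| ≤ H` for all `m` and
  `16(R+T) + 8 ≤ H`; tree `abs_dartStep_sub_le_of_mem_darts`), `loopCost_loc_enlarged` (the `hXloc` shape of the bridge);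
* §3 the bridge instances `integral_loopCost_boxKernelG_eq_of_gauge_trunc` (one loop; E2's mean) and
  `integral_loopCost_mul_boxKernelG_eq_of_gauge_trunc` (product of two loop costs; E1b's covariance), near the centre.
No new definition (the loop cost is written inline); standard axioms; no `sorry`.

HONEST LABEL: plumbing for a RECORD-label rung line (R2xi-G, leaf `WeakCouplingRates.XiPow` = an UPPER bound on the lattice mass gap for every
compact simple `G`); NOT the Clay mass gap; no summit statement is touched.

References: T. Lévy, *Wilson loops in the light of spin networks*, J. Geom. Phys. 52 (2004) §2 (gauge covariance of holonomies); E. Seiler,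
LNP 159 (1982) Ch. 2 (gauge covariance of the Wilson specification).
-/

set_option autoImplicit false

noncomputable section

open MeasureTheory Finset
open Literature.Probability.LatticeModels (Site zdGraph glueWith)
open Literature.MathematicalPhysics.QuantumLattice
open Literature.MathematicalPhysics.QuantumFieldTheory Literature.MathematicalPhysics.QuantumFieldTheory.AxialGauge
open Literature.MathematicalPhysics.QuantumFieldTheory.LatticeMaxwell
open Summit.QuantumFields.YangMills.Theorems.WeakCouplingRates
open Summit.QuantumFields.YangMills.Theorems.ColdBoxAllGroups (boxKernelG integral_boxKernelG_eq_of_gauge_trunc)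

namespace Summit.QuantumFields.YangMills.Theorems.SoftLoopLongLag

/-! ## §1 The loop cost: gauge invariance of products, continuity -/

section Invariance

variable {d N : ℕ} {G : Type*} [Group G] (ρ : G →* Matrix (Fin N) (Fin N) ℂ)

/-- The real trace of a matrix representation is a class function: `Re tr ρ(b a b⁻¹) = Re tr ρ(a)`. -/
theorem re_trace_rep_conj (a b : G) : (ρ (b * a * b⁻¹)).trace.re = (ρ a).trace.re := by
  rw [map_mul, map_mul, Matrix.trace_mul_cycle, ← map_mul, inv_mul_cancel, map_one, one_mul]

/-- The (unscaled) loop cost `N − Re tr ρ(hol_ℓ)` of a closed walk is gauge invariant (the scaled form `β·c_ℓ` is the width seat sll-p4's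
`isZdGaugeInvariant_loopCost`). -/
theorem isZdGaugeInvariant_sub_re_trace_walkHolonomy {x : Site d} (w : (zdGraph d).Walk x x) :
    IsZdGaugeInvariant fun U : LGConfig d G => (N : ℝ) - (ρ (walkHolonomy U w)).trace.re := by
  intro g U
  simp only [Literature.MathematicalPhysics.QuantumFieldTheory.Balaban1983to89.ClassLoopObservablesNotDenseSO8.walkHolonomy_gaugeTransformZd,
    re_trace_rep_conj]

/-- The product of two loop costs is gauge invariant. -/
theorem isZdGaugeInvariant_loopCost_mul {x y : Site d} (w : (zdGraph d).Walk x x) (w' : (zdGraph d).Walk y y) :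
    IsZdGaugeInvariant fun U : LGConfig d G =>
      ((N : ℝ) - (ρ (walkHolonomy U w)).trace.re) * ((N : ℝ) - (ρ (walkHolonomy U w')).trace.re) := by
  intro g U
  simp only [Literature.MathematicalPhysics.QuantumFieldTheory.Balaban1983to89.ClassLoopObservablesNotDenseSO8.walkHolonomy_gaugeTransformZd,
    re_trace_rep_conj]

end Invariance

section Bounds

variable {d N : ℕ} {G : Type*} [Group G] [TopologicalSpace G] [IsTopologicalGroup G] [CompactSpace G]
  [MeasurableSpace G] [BorelSpace G] (ρ : G →* Matrix (Fin N) (Fin N) ℂ)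

omit [CompactSpace G] [MeasurableSpace G] [BorelSpace G] in
/-- The (unscaled) loop cost is continuous (continuous `ρ`). -/
theorem continuous_sub_re_trace_walkHolonomy (hρ : Continuous ρ) {x : Site d} (w : (zdGraph d).Walk x x) :
    Continuous fun U : LGConfig d G => (N : ℝ) - (ρ (walkHolonomy U w)).trace.re :=
  continuous_const.sub (Complex.continuous_re.comp ((hρ.comp (continuous_walkHolonomy w)).matrix_trace))

omit [CompactSpace G] in
/-- The (unscaled) loop cost is measurable (continuous `ρ`, second-countable `G`). -/
theorem measurable_sub_re_trace_walkHolonomy [SecondCountableTopology G] (hρ : Continuous ρ) {x : Site d}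
    (w : (zdGraph d).Walk x x) : Measurable fun U : LGConfig d G => (N : ℝ) - (ρ (walkHolonomy U w)).trace.re :=
  (continuous_sub_re_trace_walkHolonomy ρ hρ w).measurable

end Bounds

/-! ## §2 Locality of the loop cost on the enlarged box -/

section Locality

variable {d N : ℕ} {G : Type*} [Group G] (ρ : G →* Matrix (Fin N) (Fin N) ℂ)

/-- The loop cost depends only on the links under the darts of the walk (tree `walkHolonomy_congr`). -/
theorem loopCost_eq_of_eqOn_darts {x : Site d} (w : (zdGraph d).Walk x x) (U U' : LGConfig d G)
    (h : ∀ e ∈ w.darts, U (dartStep e).1 = U' (dartStep e).1) :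
    (N : ℝ) - (ρ (walkHolonomy U w)).trace.re = (N : ℝ) - (ρ (walkHolonomy U' w)).trace.re := by
  rw [walkHolonomy_congr w h]

/-- **Edges of a near-centre rectangle lie in the enlarged box**: if `8|x_m − H| ≤ H` for every `m` and `16(R+T) + 8 ≤ H`, every edge under a dart
of `rectWalk x 1 2 R T` belongs to `boxEdgesAt dirCorner (2H+3)` (the walk stays within its length `2(R+T)` of `x`, tree
`abs_dartStep_sub_le_of_mem_darts`). -/
theorem rectWalk_edge_mem_boxEdgesAt {H : ℕ} {x : Site 4} (hx : ∀ m : Fin 4, 8 * |x m - (H : ℤ)| ≤ (H : ℤ)) {R T : ℕ}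
    (hRT : 16 * (R + T) + 8 ≤ H) {i j : Fin 4} {e : (zdGraph 4).Dart} (he : e ∈ (rectWalk x i j R T).darts) :
    (dartStep e).1 ∈ boxEdgesAt dirCorner (2 * H + 3) := by
  have hlen : ((rectWalk x i j R T).length : ℤ) = 2 * (R + T) := by
    rw [length_rectWalk]; push_cast; ring
  have hnear : ∀ k : Fin 4, |(dartStep e).1.1 k - x k| ≤ 2 * ((R : ℤ) + T) := fun k => by
    have h := abs_dartStep_sub_le_of_mem_darts (rectWalk x i j R T) he k
    rwa [hlen] at h
  rw [mem_boxEdgesAt, mem_boxEdges_iff]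
  have hRT' : (16 * (R + T) + 8 : ℤ) ≤ H := by exact_mod_cast hRT
  have hx' : ∀ k : Fin 4, -(H : ℤ) ≤ 8 * (x k - H) ∧ 8 * (x k - H) ≤ H := fun k => by
    have h2 : |8 * (x k - (H : ℤ))| ≤ H := by
      rw [abs_mul, abs_of_pos (by norm_num : (0 : ℤ) < 8)]; exact hx k
    exact abs_le.1 h2
  refine ⟨fun k => ?_, ?_⟩
  · obtain ⟨h1a, h1b⟩ := abs_le.1 (hnear k)
    obtain ⟨h2a, h2b⟩ := hx' k
    simp only [Pi.sub_apply, dirCorner]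
    constructor
    · omega
    · push_cast
      omega
  · obtain ⟨h1a, h1b⟩ := abs_le.1 (hnear (dartStep e).1.2)
    obtain ⟨h2a, h2b⟩ := hx' (dartStep e).1.2
    simp only [Pi.sub_apply, dirCorner]
    push_cast
    omega

/-- **The `hXloc` shape of the bridge for the loop cost**: configurations agreeing on the enlarged box `boxEdgesAt dirCorner (2H+3)` have the same
cost for every loop based near the centre (`8|x_m − H| ≤ H`, `16(R+T) + 8 ≤ H`). -/
theorem loopCost_loc_enlarged {H : ℕ} {x : Site 4} (hx : ∀ m : Fin 4, 8 * |x m - (H : ℤ)| ≤ (H : ℤ)) {R T : ℕ}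
    (hRT : 16 * (R + T) + 8 ≤ H) (U U' : LGConfig 4 G) (hUU' : ∀ e ∈ boxEdgesAt dirCorner (2 * H + 3), U e = U' e) :
    (N : ℝ) - (ρ (walkHolonomy U (rectWalk x 1 2 R T))).trace.re = (N : ℝ) - (ρ (walkHolonomy U' (rectWalk x 1 2 R T))).trace.re :=
  loopCost_eq_of_eqOn_darts ρ _ U U' fun _ he => hUU' _ (rectWalk_edge_mem_boxEdgesAt hx hRT he)

/-- The same for the product of two loop costs. -/
theorem loopCost_mul_loc_enlarged {H : ℕ} {x y : Site 4} (hx : ∀ m : Fin 4, 8 * |x m - (H : ℤ)| ≤ (H : ℤ))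
    (hy : ∀ m : Fin 4, 8 * |y m - (H : ℤ)| ≤ (H : ℤ)) {R T : ℕ} (hRT : 16 * (R + T) + 8 ≤ H) (U U' : LGConfig 4 G)
    (hUU' : ∀ e ∈ boxEdgesAt dirCorner (2 * H + 3), U e = U' e) :
    ((N : ℝ) - (ρ (walkHolonomy U (rectWalk x 1 2 R T))).trace.re) * ((N : ℝ) - (ρ (walkHolonomy U (rectWalk y 1 2 R T))).trace.re) =
      ((N : ℝ) - (ρ (walkHolonomy U' (rectWalk x 1 2 R T))).trace.re) *
        ((N : ℝ) - (ρ (walkHolonomy U' (rectWalk y 1 2 R T))).trace.re) := by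
  rw [loopCost_loc_enlarged ρ hx hRT U U' hUU', loopCost_loc_enlarged ρ hy hRT U U' hUU']

end Locality

/-! ## §3 The bridge instances for loops near the centre -/

section Bridge

variable {N : ℕ} {G : Type*} [Group G] [TopologicalSpace G] [IsTopologicalGroup G] [CompactSpace G]
  [MeasurableSpace G] [BorelSpace G] [SecondCountableTopology G]
variable (ρ : G →* Matrix (Fin N) (Fin N) ℂ) (hρc : Continuous ρ)
include hρc

/-- **The kernel bridge for one loop** (E2's mean): for a loop based within `H/8` of the centre with `16(R+T) + 8 ≤ H`, the kernel mean of its cost is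
the same at the datum `ω` and at the forest-fixed truncated gauge copy `W = forestFix H (glueWith E ((ω^g)|_E) 1)`, every gauge `g`. -/
theorem integral_loopCost_boxKernelG_eq_of_gauge_trunc (β : ℝ) {H : ℕ} (ω : LGConfig 4 G) (g : Site 4 → G)
    {x : Site 4} (hx : ∀ m : Fin 4, 8 * |x m - (H : ℤ)| ≤ (H : ℤ)) {R T : ℕ} (hRT : 16 * (R + T) + 8 ≤ H) :
    ∫ U, ((N : ℝ) - (ρ (walkHolonomy U (rectWalk x 1 2 R T))).trace.re) ∂(boxKernelG ρ β H ω) =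
      ∫ U, ((N : ℝ) - (ρ (walkHolonomy U (rectWalk x 1 2 R T))).trace.re) ∂(boxKernelG ρ β H
        (forestFix H (glueWith (boxEdgesAt dirCorner (2 * H + 3))
          (fun e' : ↥(boxEdgesAt dirCorner (2 * H + 3)) => gaugeTransformZd g ω e'.1) (fun _ => 1)))) :=
  integral_boxKernelG_eq_of_gauge_trunc ρ hρc β H ω g (measurable_sub_re_trace_walkHolonomy ρ hρc _)
    (isZdGaugeInvariant_sub_re_trace_walkHolonomy ρ _) (loopCost_loc_enlarged ρ hx hRT)

/-- **The kernel bridge for a product of two loop costs** (E1b's covariance): both loops based within `H/8` of the centre, `16(R+T) + 8 ≤ H`. -/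
theorem integral_loopCost_mul_boxKernelG_eq_of_gauge_trunc (β : ℝ) {H : ℕ} (ω : LGConfig 4 G) (g : Site 4 → G)
    {x y : Site 4} (hx : ∀ m : Fin 4, 8 * |x m - (H : ℤ)| ≤ (H : ℤ)) (hy : ∀ m : Fin 4, 8 * |y m - (H : ℤ)| ≤ (H : ℤ))
    {R T : ℕ} (hRT : 16 * (R + T) + 8 ≤ H) :
    ∫ U, ((N : ℝ) - (ρ (walkHolonomy U (rectWalk x 1 2 R T))).trace.re) *
        ((N : ℝ) - (ρ (walkHolonomy U (rectWalk y 1 2 R T))).trace.re) ∂(boxKernelG ρ β H ω) =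
      ∫ U, ((N : ℝ) - (ρ (walkHolonomy U (rectWalk x 1 2 R T))).trace.re) *
        ((N : ℝ) - (ρ (walkHolonomy U (rectWalk y 1 2 R T))).trace.re) ∂(boxKernelG ρ β H
        (forestFix H (glueWith (boxEdgesAt dirCorner (2 * H + 3))
          (fun e' : ↥(boxEdgesAt dirCorner (2 * H + 3)) => gaugeTransformZd g ω e'.1) (fun _ => 1)))) :=
  integral_boxKernelG_eq_of_gauge_trunc ρ hρc β H ω g
    ((measurable_sub_re_trace_walkHolonomy ρ hρc _).mul (measurable_sub_re_trace_walkHolonomy ρ hρc _))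
    (isZdGaugeInvariant_loopCost_mul ρ _ _) (loopCost_mul_loc_enlarged ρ hx hy hRT)

end Bridge

end Summit.QuantumFields.YangMills.Theorems.SoftLoopLongLag

end
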